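import Mathlib
import HarnessLib

/-!
# The trace of a polynomial in an endomorphism is the sum of its values at the eigenvalues

For an endomorphism `f` of a finite-dimensional vector space over an algebraically closed field
and a polynomial `g`: `tr g(f) = Σ_{μ ∈ roots(χ_f)} g(μ)`, the sum over the roots of the
characteristic polynomial counted with (algebraic) multiplicity. This is the endomorphism form of
Basu–Pollack–Roy, *Algorithms in Real Algebraic Geometry*, **Prop. 4.54**
("`Tr(L_f) = Σ_{x ∈ Zer(P,C)} μ(x) f(x)`" for the multiplication map `L_f` on `K[X]/(P)`, whose
characteristic polynomial is `P`), the identity behind "the Hermite matrix is the Gram matrix of the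
trace form" (ibid., Prop. 4.53; C. Hanselka, J. Algebra 487 (2017), §1, Hermite matrix). Proof as
printed (ibid.): on the generalized eigenspace of `μ`, `g(f) − g(μ)` is nilpotent (as
`g − g(μ) = (X − μ)q` and `f − μ` is nilpotent there), so its trace there is `μ(x)·g(μ)` with
`μ(x) = dim` = algebraic multiplicity; sum over the (internal direct sum of) generalized
eigenspaces.

* `trace_eq_of_isNilpotent_sub_smul` — `u − c·1` nilpotent ⇒ `tr u = c · dim`;
* `trace_restrict_aeval_maxGenEigenspace` — `tr (g(f)|_{V_μ}) = g(μ) · dim V_μ`;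
* `trace_aeval_eq_sum_roots_charpoly` — the statement for endomorphisms;
* `matrix_trace_aeval_eq_sum_roots_charpoly` — the statement for square matrices.

Mathlib has the case `g = X` (`Matrix.trace_eq_sum_roots_charpoly`) and the Hermitian case over
`ℝ`/`ℂ` via the spectral theorem, but not the general polynomial case (searched `trace_aeval`,
`sum_roots_charpoly`).

## References
* [BasuPollackRoy2006] S. Basu, R. Pollack, M.-F. Roy, Algorithms in Real Algebraic Geometry,
  Springer 2006: Prop. 4.54 and its proof, Prop. 4.53.
* [Hanselka2017] C. Hanselka, J. Algebra 487 (2017) 340–356: §1 (Hermite matrix = trace form).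
-/

noncomputable section

open Polynomial Module Set

namespace Literature.LinearAlgebra.Matrix

variable {K : Type*} [Field K] {V : Type*} [AddCommGroup V] [Module K V] [FiniteDimensional K V]

/-- If `u − c·1` is nilpotent then `tr u = c · dim`. [folklore] -/
theorem trace_eq_of_isNilpotent_sub_smul (u : End K V) (c : K)
    (h : IsNilpotent (u - c • (1 : End K V))) :
    LinearMap.trace K V u = c * (finrank K V : K) := by
  have h0 : LinearMap.trace K V (u - c • (1 : End K V)) = 0 :=
    (LinearMap.isNilpotent_trace_of_isNilpotent h).eq_zero
  rw [map_sub, map_smul, LinearMap.trace_one, smul_eq_mul, sub_eq_zero] at h0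
  exact h0

omit [FiniteDimensional K V] in
/-- `f` commutes with every polynomial in `f`. [folklore] -/
theorem commute_aeval_self (f : End K V) (q : K[X]) : Commute f (aeval f q) := by
  have h := (Commute.all (X : K[X]) q).map (aeval f)
  rwa [aeval_X] at h

/-- **On a generalized eigenspace the trace of `g(f)` is `g(μ) · dim`** (the step of the printed
proof of Basu–Pollack–Roy Prop. 4.54: "`L_{f−f(x)}` is nilpotent … so `Tr(L_f) = μ(x) f(x)`").
[cite: BasuPollackRoy2006, Prop. 4.54 (proof)] -/
theorem trace_restrict_aeval_maxGenEigenspace (f : End K V) (g : K[X]) (μ : K)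
    (h : MapsTo (aeval f g) (f.maxGenEigenspace μ) (f.maxGenEigenspace μ)) :
    LinearMap.trace K _ ((aeval f g).restrict h) =
      g.eval μ * (finrank K (f.maxGenEigenspace μ) : K) := by
  -- `g − g(μ) = (X − μ) q`
  obtain ⟨q, hq⟩ : (X - C μ) ∣ g - C (g.eval μ) := by
    rw [dvd_iff_isRoot]
    simp
  set N : End K V := f - algebraMap K (End K V) μ with hN
  have hNmaps : MapsTo N (f.maxGenEigenspace μ) (f.maxGenEigenspace μ) :=
    Module.End.mapsTo_maxGenEigenspace_of_comm (Algebra.mul_sub_algebraMap_commutes f μ) μ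
  have hNnil : IsNilpotent (N.restrict hNmaps) :=
    f.isNilpotent_restrict_maxGenEigenspace_sub_algebraMap μ
  have hfq : Commute f (aeval f q) := commute_aeval_self f q
  have hQmaps : MapsTo (aeval f q) (f.maxGenEigenspace μ) (f.maxGenEigenspace μ) :=
    Module.End.mapsTo_maxGenEigenspace_of_comm hfq μ
  have hNQ : Commute N (aeval f q) :=
    hfq.sub_left (Algebra.commute_algebraMap_left μ (aeval f q))
  -- `g(f) − g(μ)·1 = N ∘ q(f)`
  have hdecomp : aeval f g - g.eval μ • (1 : End K V) = N * aeval f q := by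
    have h1 := congrArg (aeval f) hq
    rw [map_sub, map_mul, map_sub, aeval_X, aeval_C, aeval_C, Algebra.algebraMap_eq_smul_one] at h1
    rw [h1, hN]
  refine trace_eq_of_isNilpotent_sub_smul _ _ ?_
  have hrestr : (aeval f g).restrict h - g.eval μ • (1 : End K (f.maxGenEigenspace μ)) =
      (N.restrict hNmaps) * ((aeval f q).restrict hQmaps) := by
    have hsub : MapsTo (aeval f g - g.eval μ • (1 : End K V)) (f.maxGenEigenspace μ)
        (f.maxGenEigenspace μ) := fun x hx =>
      (f.maxGenEigenspace μ).sub_mem (h hx) ((f.maxGenEigenspace μ).smul_mem _ hx)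
    calc (aeval f g).restrict h - g.eval μ • (1 : End K (f.maxGenEigenspace μ))
        = (aeval f g).restrict h - (g.eval μ • (1 : End K V)).restrict
            (fun x hx => (f.maxGenEigenspace μ).smul_mem _ hx) := by
          rw [LinearMap.restrict_smul_one]
      _ = (aeval f g - g.eval μ • (1 : End K V)).restrict hsub := LinearMap.restrict_sub _ _
      _ = (N * aeval f q).restrict (hdecomp ▸ hsub) := by
          congr 1
      _ = (N.restrict hNmaps) * ((aeval f q).restrict hQmaps) := rfl
  rw [hrestr]
  exact (LinearMap.restrict_commute hNQ hNmaps hQmaps).isNilpotent_mul_right hNnil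

/-- **`tr g(f) = Σ_{μ ∈ roots χ_f} g(μ)`** for an endomorphism `f` of a finite-dimensional vector
space over an algebraically closed field and a polynomial `g`, the roots of the characteristic
polynomial being counted with multiplicity (Basu–Pollack–Roy Prop. 4.54 in endomorphism form:
`V = ⊕_μ V_μ` (generalized eigenspaces), `tr(g(f)|V_μ) = g(μ) dim V_μ`, and
`dim V_μ` = multiplicity of `μ` in `χ_f`). [cite: BasuPollackRoy2006, Prop. 4.54] -/
theorem trace_aeval_eq_sum_roots_charpoly [IsAlgClosed K] (f : End K V) (g : K[X]) :
    LinearMap.trace K V (aeval f g) = (f.charpoly.roots.map fun μ => g.eval μ).sum := by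
  classical
  have hind : iSupIndep f.maxGenEigenspace := f.independent_maxGenEigenspace
  have htop : ⨆ μ, f.maxGenEigenspace μ = ⊤ := f.iSup_maxGenEigenspace_eq_top
  have hint : DirectSum.IsInternal f.maxGenEigenspace :=
    DirectSum.isInternal_submodule_of_iSupIndep_of_iSup_eq_top hind htop
  have hfin : {μ | f.maxGenEigenspace μ ≠ ⊥}.Finite :=
    WellFoundedGT.finite_ne_bot_of_iSupIndep hind
  have hmaps : ∀ μ, MapsTo (aeval f g) (f.maxGenEigenspace μ) (f.maxGenEigenspace μ) :=
    fun μ => Module.End.mapsTo_maxGenEigenspace_of_comm (commute_aeval_self f g) μ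
  rw [LinearMap.trace_eq_sum_trace_restrict' hint hfin hmaps]
  simp_rw [trace_restrict_aeval_maxGenEigenspace, LinearMap.finrank_maxGenEigenspace_eq]
  rw [Finset.sum_multiset_map_count]
  -- both index sets are the set of eigenvalues
  have hset : hfin.toFinset = f.charpoly.roots.toFinset := by
    ext μ
    rw [Set.Finite.mem_toFinset, Set.mem_setOf_eq, Multiset.mem_toFinset, ne_eq,
      ← Submodule.finrank_eq_zero, LinearMap.finrank_maxGenEigenspace_eq,
      ← count_roots, Multiset.count_eq_zero, not_not]
  rw [hset]
  refine Finset.sum_congr rfl fun μ _ => ?_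
  rw [count_roots, nsmul_eq_mul, mul_comm]

/-- **`tr g(M) = Σ_{μ ∈ roots χ_M} g(μ)`** for a square matrix over an algebraically closed field
(Basu–Pollack–Roy Prop. 4.54, matrix form; for `g = X` this is Mathlib's
`Matrix.trace_eq_sum_roots_charpoly`). [cite: BasuPollackRoy2006, Prop. 4.54] -/
theorem matrix_trace_aeval_eq_sum_roots_charpoly [IsAlgClosed K] {n : Type*} [Fintype n]
    [DecidableEq n] (M : Matrix n n K) (g : K[X]) :
    (aeval M g).trace = (M.charpoly.roots.map fun μ => g.eval μ).sum := by
  have hchar : (Matrix.toLin' M).charpoly = M.charpoly := by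
    rw [← LinearMap.charpoly_toMatrix (Matrix.toLin' M) (Pi.basisFun K n),
      LinearMap.toMatrix_eq_toMatrix', LinearMap.toMatrix'_toLin']
  have haeval : aeval (Matrix.toLin' M) g = Matrix.toLin' (aeval M g) := by
    have h1 := Polynomial.aeval_algEquiv (Matrix.toLinAlgEquiv' : Matrix n n K ≃ₐ[K] _) M
    have h2 := DFunLike.congr_fun h1 g
    have h3 : ∀ A : Matrix n n K, Matrix.toLinAlgEquiv' A = Matrix.toLin' A := fun A => rfl
    simp only [AlgHom.coe_comp, Function.comp_apply, h3] at h2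
    exact h2
  have htr : LinearMap.trace K _ (Matrix.toLin' (aeval M g)) = (aeval M g).trace := by
    rw [LinearMap.trace_eq_matrix_trace K (Pi.basisFun K n), LinearMap.toMatrix_eq_toMatrix',
      LinearMap.toMatrix'_toLin']
  have h := trace_aeval_eq_sum_roots_charpoly (Matrix.toLin' M) g
  rw [haeval, htr, hchar] at h
  exact h

end Literature.LinearAlgebra.Matrix
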